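import Mathlib
import Summits.NavierStokesRegularity.NavierStokesRegularity.Theorems.TaoLadderRungTwoBreakBlowupRigidityOneFiniteDepth
import HarnessLib

/-!
# NILPOTENT TABLES: if the modes can be RANKED so that every non-zero structure constant `α_{jk i,μ}` has an input of
  rank below its output (`rank j < rank i ∨ rank k < rank i`), the table is settled on BOTH sides of K2(1)
  `TaoLadderRungTwoBreak.BlowupRigidityOne` (stmt-NavierStokesRegularity-20206) at EVERY scale ratio: it has a finite
  support chain, so NO robust blow-up from any one-shell datum (`…FiniteDepth`), and it carries NO non-trivial
  admissible eternal solution (induction on the rank: an undriven renormalised mode decays like `e^{−σ}`, which the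
  action clause forbids), so the classification stub `stub_eternalIsDSS` is vacuous on it too (`--supports`)

MODEL lattice ODEs only (Tao 2016 §4 (4.1)–(4.3), Lemma 4.1 (4.5)–(4.8), (4.12), Thm. 4.2 statement shape, §6.4; §5);
nothing here is a statement about the Navier–Stokes equations; NO item is closed.  DEF-FREE (nilpotency is the displayed
hypothesis on a ranking `rank : Fin m → ℕ`); ROUTE-INDEPENDENT.

* `supportChain_of_nilpotent`, `not_noGlobalCascade_of_nilpotent` — the sets `D s = {i : s ≤ rank i}` form a support
  chain of depth `sup rank` ((O), (A), (B) of `…FiniteDepth`, `D 0 = univ`, `D (sup rank + 1) = ∅`); hence on `E₂(R)`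
  no robust blow-up at any `ε₀ > 0` from any datum;
* `hasDerivAt_apply_of_isEternal`, `qform_eq_zero_of_lowRank` — bookkeeping: components of the
  eternal law, and the vanishing of every driving form whose low-rank inputs vanish;
* `eternal_trivial_of_nilpotent`, `not_eternalSurvivingFwd_of_nilpotent`, `stubEternalIsDSS_on_nilpotent` — every
  admissible eternal solution (`IsEternal`, any `ε₀`) of a nilpotent table is `0`; no forward survival; the
  classification stub holds there vacuously;
* `nilpotent_liveTable` — the LIVE spread-one table of `…OneHopTables` (`α_{123,(001)} = α_{213,(001)} = 1`,
  `α_{312,(100)} = α_{132,(010)} = −1`) is nilpotent with ranks `(0,0,1,1)`: a member of `E₂(1)` with live cross outflow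
  on which the hypothesis classes of BOTH registered stubs are void at every `ε₀`.

* `hasDerivAt_apply_of_isDSSWave`, `dssWave_trivial_of_nilpotent`, `liveTable_dssWave_trivial` (appended) — the
  WAVE side: every admissible DSS wave of a nilpotent table is trivial (any `ε₀`, delay, profile family), so K1(1)
  `NoSurvivingDSSOne` holds there outright and the conclusion of K2(1) is unattainable — consistently with its void
  hypothesis.

READING for the census: below the dyadic spread both stubs of K2(1) and the rung leaf have content only on tables with
a driving CYCLE in the mode ranking (re-pairing) — the twin rotor (`x₀x₁ ↦ x₀, x₁` of the next shell) is the minimal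
one, and it carries (D).  HONEST LABEL: calibration of one aside leaf on an explicit sub-class; no stub, crux, rung or
summit is proved; rung 0.
-/

noncomputable section

-- the summit and its single sub-problem share the name (CONVENTIONS §1)
set_option linter.dupNamespace false

open Set Filter Topology MeasureTheory
open scoped RealInnerProductSpace

namespace Summit.NavierStokesRegularity.NavierStokesRegularity.Theorems

namespace BlowupRigidityOne

open Literature.Analysis.FluidPDE Literature.Analysis.FluidPDE.TaoCascade
  Literature.Analysis.FluidPDE.Tao2016AveragedNS

variable {m : ℕ} {R ε₀ : ℝ} {α : Fin m → Fin m → Fin m → ℤ × ℤ × ℤ → ℝ}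

/-! ## Nilpotent tables have a finite support chain -/

/-- **The rank filtration of a nilpotent table is a support chain.**  If every non-zero `α_{jk i,μ}` (`μ ∈ S`) has
`rank j < rank i` or `rank k < rank i`, then `D s := {i : s ≤ rank i}` satisfies (O), (A), (B) of `…FiniteDepth`:
a monomial with both inputs of rank `≥ s` (resp. `≥ s+1`, `≥ s`) outputs rank `> s`.
[cite: Tao2016AveragedNS, §4 (4.1); cell vocabulary (support chain, nilpotent ranking)] -/
theorem supportChain_of_nilpotent (rank : Fin m → ℕ)
    (hnil : ∀ μ ∈ shiftSet, ∀ j k i, α j k i μ ≠ 0 → rank j < rank i ∨ rank k < rank i) :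
    (∀ n j k i, j ∈ Finset.univ.filter (fun i => n ≤ rank i) → k ∈ Finset.univ.filter (fun i => n ≤ rank i) →
        i ∉ Finset.univ.filter (fun i => n + 1 ≤ rank i) → α j k i ((0 : ℤ), (0 : ℤ), (1 : ℤ)) = 0) ∧
    (∀ n j k i, j ∈ Finset.univ.filter (fun i => n ≤ rank i) → k ∈ Finset.univ.filter (fun i => n ≤ rank i) →
        i ∉ Finset.univ.filter (fun i => n ≤ rank i) → α j k i ((0 : ℤ), (0 : ℤ), (0 : ℤ)) = 0) ∧
    (∀ n j k i, j ∈ Finset.univ.filter (fun i => n + 1 ≤ rank i) → k ∈ Finset.univ.filter (fun i => n ≤ rank i) →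
        i ∉ Finset.univ.filter (fun i => n ≤ rank i) →
          α j k i ((1 : ℤ), (0 : ℤ), (0 : ℤ)) = 0 ∧ α k j i ((0 : ℤ), (1 : ℤ), (0 : ℤ)) = 0) := by
  have h001 : ((0 : ℤ), (0 : ℤ), (1 : ℤ)) ∈ shiftSet := by simp [shiftSet]
  have h000 : ((0 : ℤ), (0 : ℤ), (0 : ℤ)) ∈ shiftSet := by simp [shiftSet]
  have h100 : ((1 : ℤ), (0 : ℤ), (0 : ℤ)) ∈ shiftSet := by simp [shiftSet]
  have h010 : ((0 : ℤ), (1 : ℤ), (0 : ℤ)) ∈ shiftSet := by simp [shiftSet]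
  simp only [Finset.mem_filter, Finset.mem_univ, true_and, not_le]
  refine ⟨fun n j k i hj hk hi => ?_, fun n j k i hj hk hi => ?_, fun n j k i hj hk hi => ⟨?_, ?_⟩⟩ <;>
    by_contra hne
  · rcases hnil _ h001 j k i hne with h | h <;> omega
  · rcases hnil _ h000 j k i hne with h | h <;> omega
  · rcases hnil _ h100 j k i hne with h | h <;> omega
  · rcases hnil _ h010 k j i hne with h | h <;> omega

/-- **NILPOTENT TABLES NEVER BLOW UP ROBUSTLY.**  If `α ∈ E₂(R)` admits a ranking of its modes with every non-zero
structure constant having an input of rank below its output, then `¬ NoGlobalCascade ε₀ α X₀` for EVERY `ε₀ > 0` and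
EVERY one-shell datum `X₀`: the rank filtration is a support chain of depth `sup rank` (`supportChain_of_nilpotent`),
and finite-depth tables carry a global exact flow (`not_noGlobalCascade_of_supportChain_univ`).  K2(1) and the rung
leaf hold on such tables with no threshold (vacuously).
[cite: Tao2016AveragedNS, §4 Thm. 4.2 (statement shape), Lemma 4.1 (4.5)–(4.8), §5 p. 25; cell vocabulary (`NoGlobalCascade`)] -/
theorem not_noGlobalCascade_of_nilpotent (hε : 0 < ε₀) (hα : InTableClass R α) (rank : Fin m → ℕ)
    (hnil : ∀ μ ∈ shiftSet, ∀ j k i, α j k i μ ≠ 0 → rank j < rank i ∨ rank k < rank i) (X₀ : Fin m → ℝ) :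
    ¬ NoGlobalCascade ε₀ α X₀ := by
  obtain ⟨hO, hA, hB⟩ := supportChain_of_nilpotent rank hnil
  refine not_noGlobalCascade_of_supportChain_univ (K := Finset.univ.sup rank)
    (D := fun s => Finset.univ.filter (fun i => s ≤ rank i)) hε hα ?_ ?_ hO hA hB X₀
  · ext i; simp
  · ext i
    simp only [Finset.mem_filter, Finset.mem_univ, true_and, Finset.notMem_empty, iff_false, not_le]
    exact Nat.lt_succ_of_le (Finset.le_sup (f := rank) (Finset.mem_univ i))

/-! ## Nilpotent tables carry no admissible eternal solution -/

/-- Components of the eternal law: `(W_n)_i' = −(W_n)_i + [Q(W_n) + Λ A(W_{n−1}) + Λ⁻¹ B(W_{n+1}, W_n)]_i`.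
[cite: Tao2016AveragedNS, §4 Lemma 4.1 (iii) (4.8) in self-similar variables (§6.4); cell vocabulary (`IsEternal`)] -/
theorem hasDerivAt_apply_of_isEternal {W : ℤ → ℝ → Em m} (hW : IsEternal ε₀ α W) (n : ℤ) (σ : ℝ) (i : Fin m) :
    HasDerivAt (fun σ => W n σ i)
      (-(W n σ i) + (tableQ α (W n σ) i + bigLam ε₀ * tableA α (W (n - 1) σ) i
        + (bigLam ε₀)⁻¹ * tableB α (W (n + 1) σ) (W n σ) i)) σ := by
  have h := ((EuclideanSpace.proj i : Em m →L[ℝ] ℝ).hasFDerivAt.comp_hasDerivAt σ (hW.law n σ))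
  have e : (EuclideanSpace.proj i : Em m →L[ℝ] ℝ) (-((1 : ℝ) • W n σ) + tableQ α (W n σ)
      + bigLam ε₀ • tableA α (W (n - 1) σ) + (bigLam ε₀)⁻¹ • tableB α (W (n + 1) σ) (W n σ))
      = -(W n σ i) + (tableQ α (W n σ) i + bigLam ε₀ * tableA α (W (n - 1) σ) i
        + (bigLam ε₀)⁻¹ * tableB α (W (n + 1) σ) (W n σ) i) := by
    rw [EuclideanSpace.coe_proj]
    simp only [PiLp.add_apply, PiLp.neg_apply, PiLp.smul_apply, smul_eq_mul, one_mul]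
    ring
  rw [e] at h
  exact h

/-- A driving form vanishes at an output mode `i` as soon as, for every non-zero coefficient, one of the two inputs is
a mode whose amplitude vanishes — here: all modes of rank `< rank i` vanish in both input vectors.
[cite: Tao2016AveragedNS, §4 (4.1); cell vocabulary (`qform`, nilpotent ranking)] -/
theorem qform_eq_zero_of_lowRank (rank : Fin m → ℕ) {μ : ℤ × ℤ × ℤ}
    (hnil : ∀ j k i, α j k i μ ≠ 0 → rank j < rank i ∨ rank k < rank i) (y x : Em m) (i : Fin m)
    (hy : ∀ j, rank j < rank i → y j = 0) (hx : ∀ j, rank j < rank i → x j = 0) : qform α μ y x i = 0 := by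
  unfold qform
  refine Finset.sum_eq_zero fun j _ => Finset.sum_eq_zero fun k _ => ?_
  by_cases h : α j k i μ = 0
  · rw [h, zero_mul]
  · rcases hnil j k i h with hj | hk
    · rw [hy j hj, zero_mul, mul_zero]
    · rw [hx k hk, mul_zero, mul_zero]

/-- **NO NON-TRIVIAL ADMISSIBLE ETERNAL SOLUTION ON A NILPOTENT TABLE.**  If every non-zero structure constant has an
input of rank below its output, then every admissible eternal solution of the renormalised lattice (`IsEternal ε₀ α W`,
ANY `ε₀`) vanishes identically: by induction on the rank, a mode all of whose drivers contain an already-vanishing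
factor obeys `(W_n)_i' = −(W_n)_i`, i.e. `(W_n)_i(σ) = (W_n)_i(0) e^{−σ}`, and the ACTION clause (`σ ↦ ‖W_n(σ)‖`
integrable on `ℝ`) forces `(W_n)_i(0) = 0` (`not_integrable_exp_neg`).
[cite: Tao2016AveragedNS, §4 (4.1), Lemma 4.1 (iii) (4.8) in self-similar variables (§6.4); cell vocabulary (`IsEternal`, clause `action`)] -/
theorem eternal_trivial_of_nilpotent (rank : Fin m → ℕ)
    (hnil : ∀ μ ∈ shiftSet, ∀ j k i, α j k i μ ≠ 0 → rank j < rank i ∨ rank k < rank i)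
    {W : ℤ → ℝ → Em m} (hW : IsEternal ε₀ α W) : ∀ n σ, W n σ = 0 := by
  have h001 : ((0 : ℤ), (0 : ℤ), (1 : ℤ)) ∈ shiftSet := by simp [shiftSet]
  have h000 : ((0 : ℤ), (0 : ℤ), (0 : ℤ)) ∈ shiftSet := by simp [shiftSet]
  have h100 : ((1 : ℤ), (0 : ℤ), (0 : ℤ)) ∈ shiftSet := by simp [shiftSet]
  have h010 : ((0 : ℤ), (1 : ℤ), (0 : ℤ)) ∈ shiftSet := by simp [shiftSet]
  -- induction on the rank: all modes of rank `< r` vanish on every shell at every log-time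
  suffices hmain : ∀ r : ℕ, ∀ i : Fin m, rank i < r → ∀ n σ, W n σ i = 0 by
    intro n σ; ext i; exact hmain (rank i + 1) i (Nat.lt_succ_self _) n σ
  intro r
  induction r with
  | zero => intro i hi; exact absurd hi (Nat.not_lt_zero _)
  | succ r ih =>
    intro i hi n
    -- the lower-rank modes vanish, so mode `i` is undriven
    have hlow : ∀ n' σ j, rank j < rank i → W n' σ j = 0 :=
      fun n' σ j hj => ih j (by omega) n' σ
    have hR : ∀ σ, tableQ α (W n σ) i + bigLam ε₀ * tableA α (W (n - 1) σ) i
        + (bigLam ε₀)⁻¹ * tableB α (W (n + 1) σ) (W n σ) i = 0 := by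
      intro σ
      rw [tableQ_apply, tableA_apply, tableB_apply,
        qform_eq_zero_of_lowRank rank (hnil _ h000) _ _ i (hlow n σ) (hlow n σ),
        qform_eq_zero_of_lowRank rank (hnil _ h001) _ _ i (hlow (n - 1) σ) (hlow (n - 1) σ),
        qform_eq_zero_of_lowRank rank (hnil _ h100) _ _ i (hlow (n + 1) σ) (hlow n σ),
        qform_eq_zero_of_lowRank rank (hnil _ h010) _ _ i (hlow n σ) (hlow (n + 1) σ)]
      ring
    -- `f' = -f` for `f = (W_n)_i`
    have hder : ∀ σ, HasDerivAt (fun σ => W n σ i) (-(W n σ i)) σ := by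
      intro σ
      have h := hasDerivAt_apply_of_isEternal hW n σ i
      rw [hR σ, add_zero] at h
      exact h
    -- hence `e^{σ} f(σ)` is constant
    have hconst : ∀ σ, Real.exp σ * W n σ i = W n 0 i := by
      intro σ
      have hd : ∀ w, HasDerivAt (fun w => Real.exp w * W n w i) 0 w := by
        intro w
        have h1 := (Real.hasDerivAt_exp w).mul (hder w)
        have e : Real.exp w * W n w i + Real.exp w * -(W n w i) = 0 := by ring
        rw [e] at h1
        exact h1
      have h := is_const_of_deriv_eq_zero (f := fun w => Real.exp w * W n w i)
        (fun w => (hd w).differentiableAt) (fun w => (hd w).deriv) σ 0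
      simpa using h
    have hform : ∀ σ, W n σ i = W n 0 i * Real.exp (-σ) := by
      intro σ
      have h := hconst σ
      have hexp : Real.exp σ * Real.exp (-σ) = 1 := by rw [← Real.exp_add, add_neg_cancel, Real.exp_zero]
      calc W n σ i = Real.exp σ * W n σ i * Real.exp (-σ) := by
            rw [mul_comm (Real.exp σ), mul_assoc, hexp, mul_one]
        _ = W n 0 i * Real.exp (-σ) := by rw [h]
    -- the action clause forces `(W_n)_i(0) = 0`
    have h0 : W n 0 i = 0 := by
      by_contra hne
      obtain ⟨M, hM⟩ := hW.action
      have hint : Integrable (fun σ => W n σ i) := by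
        refine (hM n).1.mono' ?_ (Eventually.of_forall fun σ => ?_)
        · exact (continuous_iff_continuousAt.2 fun σ => (hder σ).continuousAt).aestronglyMeasurable
        · rw [Real.norm_eq_abs]
          exact abs_apply_le_norm (W n σ) i
      have heq : (fun σ => W n σ i) = fun σ => W n 0 i * Real.exp (-σ) := funext hform
      rw [heq] at hint
      have hexp : Integrable (fun σ : ℝ => Real.exp (-σ)) := by
        have := hint.const_mul ((W n 0 i)⁻¹)
        refine this.congr (Eventually.of_forall fun σ => ?_)
        simp only
        rw [← mul_assoc, inv_mul_cancel₀ hne, one_mul]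
      exact not_integrable_exp_neg hexp
    intro σ
    rw [hform σ, h0, zero_mul]

/-- **No admissible eternal solution of a nilpotent table is (S_a)-surviving forward** (any `a`, any `ε₀`).
[cite: Tao2016AveragedNS, §4 (4.8), §6.4; cell vocabulary (`IsEternal`, `EternalSurvivingFwd`)] -/
theorem not_eternalSurvivingFwd_of_nilpotent (rank : Fin m → ℕ)
    (hnil : ∀ μ ∈ shiftSet, ∀ j k i, α j k i μ ≠ 0 → rank j < rank i ∨ rank k < rank i)
    {W : ℤ → ℝ → Em m} (hW : IsEternal ε₀ α W) (a : ℝ) : ¬ EternalSurvivingFwd a ε₀ W := by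
  rintro ⟨c, hc0, H⟩
  obtain ⟨n, -, σ, -, hle⟩ := H 0
  rw [eternal_trivial_of_nilpotent rank hnil hW n σ, norm_zero] at hle
  simp only [ne_eq, OfNat.ofNat_ne_zero, not_false_eq_true, zero_pow, mul_zero] at hle
  exact absurd hle (not_le.2 hc0)

/-- **THE CLASSIFICATION STUB ON NILPOTENT TABLES, EVERY `ε₀`.**  The implication of the registered stub
`stub_eternalIsDSS` of K2(1) holds for every nilpotent table and EVERY `ε₀`, because its hypothesis is void there.
[cite: Tao2016AveragedNS, §4 (4.8), §6.4; cell vocabulary (`stub_eternalIsDSS` of skeleton 9d85f4d387c689cd)] -/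
theorem stubEternalIsDSS_on_nilpotent (rank : Fin m → ℕ)
    (hnil : ∀ μ ∈ shiftSet, ∀ j k i, α j k i μ ≠ 0 → rank j < rank i ∨ rank k < rank i) (ε₀ : ℝ)
    (hex : ∃ W : ℤ → ℝ → Em m, IsEternal ε₀ α W ∧ EternalSurvivingFwd 1 ε₀ W) :
    ∃ (q : ℕ) (π : Equiv.Perm (Fin q)) (T : ℝ) (Φ : Fin q → ℝ → Em m),
      IsDSSWave ε₀ α π T Φ ∧ Surviving 1 ε₀ T ∧ ∃ r x, Φ r x ≠ 0 := by
  obtain ⟨W, hW, hS⟩ := hex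
  exact absurd hS (not_eternalSurvivingFwd_of_nilpotent rank hnil hW 1)

/-! ## The live spread-one table is nilpotent -/

/-- **The live spread-one table is nilpotent** with ranks `(0, 0, 1, 1)`: its non-zero constants are
`α_{123,(001)} = α_{213,(001)} = 1` (output `3`, input `1` of rank `0`) and `α_{312,(100)} = α_{132,(010)} = −1`
(output `2`, input `1` of rank `0`).  Hence (`not_noGlobalCascade_of_nilpotent`, `eternal_trivial_of_nilpotent`) a
member of `E₂(1)` with a live cross outflow on which the hypothesis classes of BOTH registered stubs of K2(1) are void
at every `ε₀`.
[cite: Tao2016AveragedNS, §4 (4.1)–(4.3), §6.1; cell vocabulary (`InTableClass`)] -/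
theorem nilpotent_liveTable :
    ∀ μ ∈ shiftSet, ∀ j k i : Fin 4,
      (fun (i₁ i₂ i₃ : Fin 4) (μ : ℤ × ℤ × ℤ) =>
        if i₃ = 3 ∧ ((i₁ = 1 ∧ i₂ = 2) ∨ (i₁ = 2 ∧ i₂ = 1)) ∧ μ = ((0 : ℤ), (0 : ℤ), (1 : ℤ)) then (1 : ℝ)
        else if i₁ = 3 ∧ i₂ = 1 ∧ i₃ = 2 ∧ μ = ((1 : ℤ), (0 : ℤ), (0 : ℤ)) then -1
        else if i₁ = 1 ∧ i₂ = 3 ∧ i₃ = 2 ∧ μ = ((0 : ℤ), (1 : ℤ), (0 : ℤ)) then -1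
        else 0) j k i μ ≠ 0 →
      (![0, 0, 1, 1] : Fin 4 → ℕ) j < (![0, 0, 1, 1] : Fin 4 → ℕ) i ∨
        (![0, 0, 1, 1] : Fin 4 → ℕ) k < (![0, 0, 1, 1] : Fin 4 → ℕ) i := by
  intro μ hμ j k i hne
  rw [mem_shiftSet_iff] at hμ
  rcases hμ with rfl | rfl | rfl | rfl <;>
    fin_cases j <;> fin_cases k <;> fin_cases i <;> simp_all

/-- **The live spread-one table carries no non-trivial admissible eternal solution and no robust blow-up, at every
`ε₀`.** [cite: Tao2016AveragedNS, §4 (4.1)–(4.3), Thm. 4.2 (statement shape), §6.1, §6.4; cell vocabulary] -/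
theorem liveTable_settled_both_sides (hε : 0 < ε₀) :
    let α : Fin 4 → Fin 4 → Fin 4 → ℤ × ℤ × ℤ → ℝ := fun i₁ i₂ i₃ μ =>
      if i₃ = 3 ∧ ((i₁ = 1 ∧ i₂ = 2) ∨ (i₁ = 2 ∧ i₂ = 1)) ∧ μ = ((0 : ℤ), (0 : ℤ), (1 : ℤ)) then (1 : ℝ)
      else if i₁ = 3 ∧ i₂ = 1 ∧ i₃ = 2 ∧ μ = ((1 : ℤ), (0 : ℤ), (0 : ℤ)) then -1
      else if i₁ = 1 ∧ i₂ = 3 ∧ i₃ = 2 ∧ μ = ((0 : ℤ), (1 : ℤ), (0 : ℤ)) then -1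
      else 0
    (∀ X₀ : Fin 4 → ℝ, ¬ NoGlobalCascade ε₀ α X₀) ∧
      ∀ W : ℤ → ℝ → Em 4, IsEternal ε₀ α W → ∀ n σ, W n σ = 0 := by
  intro α
  exact ⟨fun X₀ => not_noGlobalCascade_of_nilpotent hε inTableClass_one_liveTable _ nilpotent_liveTable X₀,
    fun W hW => eternal_trivial_of_nilpotent _ nilpotent_liveTable hW⟩

/-! ## Nilpotent tables carry no admissible DSS wave (appended) -/

/-- Components of the profile law of a DSS wave:
`(Φ_r)_i' = −(Φ_r)_i + [Q(Φ_r) + Λ A(Φ_{π⁻¹r}(·+T)) + Λ⁻¹ B(Φ_{πr}(·−T), Φ_r)]_i`.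
[cite: Tao2016AveragedNS, §4 Lemma 4.1 (iii) (4.8) in self-similar variables; cell vocabulary (`IsDSSWave`, `IsSWave`)] -/
theorem hasDerivAt_apply_of_isDSSWave {ρ : Type*} [Fintype ρ] {π : Equiv.Perm ρ} {T : ℝ} {Φ : ρ → ℝ → Em m}
    (hW : IsDSSWave ε₀ α π T Φ) (r : ρ) (x : ℝ) (i : Fin m) :
    HasDerivAt (fun x => Φ r x i)
      (-(Φ r x i) + (tableQ α (Φ r x) i + bigLam ε₀ * tableA α (Φ (π.symm r) (x + T)) i
        + (bigLam ε₀)⁻¹ * tableB α (Φ (π r) (x - T)) (Φ r x) i)) x := by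
  have h := ((EuclideanSpace.proj i : Em m →L[ℝ] ℝ).hasFDerivAt.comp_hasDerivAt x (hW.wave r x))
  have e : (EuclideanSpace.proj i : Em m →L[ℝ] ℝ) (-((1 : ℝ) • Φ r x) + tableQ α (Φ r x)
      + bigLam ε₀ • tableA α (Φ (π.symm r) (x + T)) + (bigLam ε₀)⁻¹ • tableB α (Φ (π r) (x - T)) (Φ r x))
      = -(Φ r x i) + (tableQ α (Φ r x) i + bigLam ε₀ * tableA α (Φ (π.symm r) (x + T)) i
        + (bigLam ε₀)⁻¹ * tableB α (Φ (π r) (x - T)) (Φ r x) i) := by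
    rw [EuclideanSpace.coe_proj]
    simp only [PiLp.add_apply, PiLp.neg_apply, PiLp.smul_apply, smul_eq_mul, one_mul]
    ring
  rw [e] at h
  exact h

/-- **NO NON-TRIVIAL ADMISSIBLE DSS WAVE ON A NILPOTENT TABLE.**  If every non-zero structure constant has an input of
rank below its output, then every admissible DSS wave (`IsDSSWave ε₀ α π T Φ`, ANY `ε₀`, any delay, any finite profile
family) is trivial: by induction on the rank an undriven profile component obeys `f' = −f`, i.e. `f(x) = f(0)e^{−x}`,
which the integrable-summed-mass clause excludes unless `f(0) = 0`.  (So on nilpotent tables K1(1)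
`NoSurvivingDSSOne` holds outright and the CONCLUSION of K2(1) is unattainable — consistently, its hypothesis is void
there too: `not_noGlobalCascade_of_nilpotent`.)
[cite: Tao2016AveragedNS, §4 (4.1), Lemma 4.1 (iii) (4.8); cell vocabulary (`IsDSSWave`, clause `mass`)] -/
theorem dssWave_trivial_of_nilpotent (rank : Fin m → ℕ)
    (hnil : ∀ μ ∈ shiftSet, ∀ j k i, α j k i μ ≠ 0 → rank j < rank i ∨ rank k < rank i)
    {ρ : Type*} [Fintype ρ] {π : Equiv.Perm ρ} {T : ℝ} {Φ : ρ → ℝ → Em m}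
    (hW : IsDSSWave ε₀ α π T Φ) : ∀ r x, Φ r x = 0 := by
  have h001 : ((0 : ℤ), (0 : ℤ), (1 : ℤ)) ∈ shiftSet := by simp [shiftSet]
  have h000 : ((0 : ℤ), (0 : ℤ), (0 : ℤ)) ∈ shiftSet := by simp [shiftSet]
  have h100 : ((1 : ℤ), (0 : ℤ), (0 : ℤ)) ∈ shiftSet := by simp [shiftSet]
  have h010 : ((0 : ℤ), (1 : ℤ), (0 : ℤ)) ∈ shiftSet := by simp [shiftSet]
  suffices hmain : ∀ n : ℕ, ∀ i : Fin m, rank i < n → ∀ r x, Φ r x i = 0 by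
    intro r x; ext i; exact hmain (rank i + 1) i (Nat.lt_succ_self _) r x
  intro n
  induction n with
  | zero => intro i hi; exact absurd hi (Nat.not_lt_zero _)
  | succ n ih =>
    intro i hi r
    have hlow : ∀ r' x j, rank j < rank i → Φ r' x j = 0 := fun r' x j hj => ih j (by omega) r' x
    have hR : ∀ x, tableQ α (Φ r x) i + bigLam ε₀ * tableA α (Φ (π.symm r) (x + T)) i
        + (bigLam ε₀)⁻¹ * tableB α (Φ (π r) (x - T)) (Φ r x) i = 0 := by
      intro x
      rw [tableQ_apply, tableA_apply, tableB_apply,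
        qform_eq_zero_of_lowRank rank (hnil _ h000) _ _ i (hlow r x) (hlow r x),
        qform_eq_zero_of_lowRank rank (hnil _ h001) _ _ i (hlow _ _) (hlow _ _),
        qform_eq_zero_of_lowRank rank (hnil _ h100) _ _ i (hlow _ _) (hlow r x),
        qform_eq_zero_of_lowRank rank (hnil _ h010) _ _ i (hlow r x) (hlow _ _)]
      ring
    have hder : ∀ x, HasDerivAt (fun x => Φ r x i) (-(Φ r x i)) x := by
      intro x
      have h := hasDerivAt_apply_of_isDSSWave hW r x i
      rw [hR x, add_zero] at h
      exact h
    have hconst : ∀ x, Real.exp x * Φ r x i = Φ r 0 i := by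
      intro x
      have hd : ∀ w, HasDerivAt (fun w => Real.exp w * Φ r w i) 0 w := by
        intro w
        have h1 := (Real.hasDerivAt_exp w).mul (hder w)
        have e : Real.exp w * Φ r w i + Real.exp w * -(Φ r w i) = 0 := by ring
        rw [e] at h1
        exact h1
      have h := is_const_of_deriv_eq_zero (f := fun w => Real.exp w * Φ r w i)
        (fun w => (hd w).differentiableAt) (fun w => (hd w).deriv) x 0
      simpa using h
    have hform : ∀ x, Φ r x i = Φ r 0 i * Real.exp (-x) := by
      intro x
      have h := hconst x
      have hexp : Real.exp x * Real.exp (-x) = 1 := by rw [← Real.exp_add, add_neg_cancel, Real.exp_zero]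
      calc Φ r x i = Real.exp x * Φ r x i * Real.exp (-x) := by
            rw [mul_comm (Real.exp x), mul_assoc, hexp, mul_one]
        _ = Φ r 0 i * Real.exp (-x) := by rw [h]
    have h0 : Φ r 0 i = 0 := by
      by_contra hne
      -- `|Φ_r(·)_i| ≤ ‖Φ_r(·)‖ ≤ sMass Φ` is integrable
      have hint : Integrable (fun x => Φ r x i) := by
        refine hW.mass.mono' ?_ (Eventually.of_forall fun x => ?_)
        · exact (continuous_iff_continuousAt.2 fun x => (hder x).continuousAt).aestronglyMeasurable
        · rw [Real.norm_eq_abs]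
          exact (abs_apply_le_norm (Φ r x) i).trans
            (Finset.single_le_sum (f := fun r' => ‖Φ r' x‖) (fun r' _ => norm_nonneg _) (Finset.mem_univ r))
      have heq : (fun x => Φ r x i) = fun x => Φ r 0 i * Real.exp (-x) := funext hform
      rw [heq] at hint
      have hexp : Integrable (fun x : ℝ => Real.exp (-x)) := by
        have := hint.const_mul ((Φ r 0 i)⁻¹)
        refine this.congr (Eventually.of_forall fun x => ?_)
        simp only
        rw [← mul_assoc, inv_mul_cancel₀ hne, one_mul]
      exact not_integrable_exp_neg hexp
    intro x
    rw [hform x, h0, zero_mul]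

/-- **The live spread-one table carries no non-trivial admissible DSS wave** (any `ε₀`, any delay, any profile family).
[cite: Tao2016AveragedNS, §4 (4.1)–(4.3), Lemma 4.1 (iii) (4.8), §6.1; cell vocabulary] -/
theorem liveTable_dssWave_trivial {ρ : Type*} [Fintype ρ] {π : Equiv.Perm ρ} {T : ℝ} {Φ : ρ → ℝ → Em 4}
    (hW : IsDSSWave ε₀ (fun (i₁ i₂ i₃ : Fin 4) (μ : ℤ × ℤ × ℤ) =>
      if i₃ = 3 ∧ ((i₁ = 1 ∧ i₂ = 2) ∨ (i₁ = 2 ∧ i₂ = 1)) ∧ μ = ((0 : ℤ), (0 : ℤ), (1 : ℤ)) then (1 : ℝ)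
      else if i₁ = 3 ∧ i₂ = 1 ∧ i₃ = 2 ∧ μ = ((1 : ℤ), (0 : ℤ), (0 : ℤ)) then -1
      else if i₁ = 1 ∧ i₂ = 3 ∧ i₃ = 2 ∧ μ = ((0 : ℤ), (1 : ℤ), (0 : ℤ)) then -1
      else 0) π T Φ) : ∀ r x, Φ r x = 0 :=
  dssWave_trivial_of_nilpotent _ nilpotent_liveTable hW

end BlowupRigidityOne

end Summit.NavierStokesRegularity.NavierStokesRegularity.Theorems

end
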